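import Summits.BirchSwinnertonDyer.BirchSwinnertonDyer.Theorems.TameQuarticManinParityPrymLatticeFixedPointSpanOfPeriodKernelFact
import Summits.BirchSwinnertonDyer.BirchSwinnertonDyer.Theorems.TameQuarticManinParityEisensteinSplitOfFixedPointSymbols
import Summits.BirchSwinnertonDyer.BirchSwinnertonDyer.Theorems.TameQuarticManinParityTprimeIrrModThreeSaturationFixedPointSymbolHeckeShift
import Summits.BirchSwinnertonDyer.BirchSwinnertonDyer.Theorems.TameQuarticManinParityPrymDefectAvoidsThreeOfEisensteinSplit
import Summits.BirchSwinnertonDyer.BirchSwinnertonDyer.Theorems.TameQuarticManinParityIrrModThreeSplitTraceWitness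
import Literature.NumberTheory.ModularSymbols.PeriodHomologyGroupPresentationProofs
import HarnessLib

/-!
# Route `TameQuarticManinParity`, organ below the crux MS `TprimeIrrModThreeSaturation` (stmt-BirchSwinnertonDyer-23367):
# the whole H2 branch is now UNCONDITIONAL — E32a `PrymLatticeFixedPointSpan` (stmt-23756), E30
# `PrymDefectHeckeEisensteinSplit` (stmt-23597) and H2 `TprimeIrrPrymDefectAvoidsThree` (stmt-23480) PROVED BY NAME
# (lead `cruxlead-stmt-BirchSwinnertonDyer-23367` g3, line `abelian-fixed-points`)

With Knapp's Prop. 11.22 now a THEOREM (`Literature.NumberTheory.ModularSymbols.periodFunctional_ker_le_ellipticParabolic_sup_commutator_holds`,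
`PeriodHomologyGroupPresentationProofs`, the mod-`ℓ` cocycle count of LINE 36; an independent chain-sum road is landed as
`…TameQuarticManinParityCuspCharacterFactorAnyGroup`), the landed conditional readings compose to unconditional proofs:
* `prymLatticeFixedPointSpan_proof : PrymLatticeFixedPointSpan` (E32a; typer tqmp-ty1 g30's Literature theorem p678944 read
  by name in p679807, applied to the proved fact);
* `prymDefectHeckeEisensteinSplit_proof : PrymDefectHeckeEisensteinSplit` (E30 ⇐ E32a ∧ E32b, glue `heckeEisensteinSplit_of`
  p679806, E32b = `stub_fixedPointSymbolHeckeShift` p682044);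
* `tprimeIrrPrymDefectAvoidsThree_proof : TprimeIrrPrymDefectAvoidsThree` (H2 ⇐ E30 ∧ B30, glue p673875, B30 =
  `stub_traceWitness` p675317).
So the crux MS is closed modulo the three Galois-side named facts ONLY (Edixhoven 1992 Thm. 4.5, DDT95 Thm. 3.1(g),
Deligne–Serre 6.1) — see `…TprimeIrrModThreeSaturationOfGaloisFacts`.  THEOREMS ONLY; no definition, no named fact, no
`sorry`.  No summit is proved; BSD is NOT proved.
-/

set_option autoImplicit false
-- D-0017: single-problem summit, so `Summit.BirchSwinnertonDyer.BirchSwinnertonDyer.…` repeats a namespace BY DESIGN.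
set_option linter.dupNamespace false

noncomputable section

namespace Summit.BirchSwinnertonDyer.BirchSwinnertonDyer.Theorems.TameQuarticManinParity

open Summit.BirchSwinnertonDyer.BirchSwinnertonDyer.Theses.TameQuarticManinParity

/-- **E32a `PrymLatticeFixedPointSpan` (stmt-BirchSwinnertonDyer-23756), PROVED**: for every `N` with `9 ∣ N` the Prym
lattice `Λ_P = ker(1 + t + t²)` of the period lattice lies in `(t − 1)Λ + ℤ{ {∞, γ∞} : γ ∈ Γ₀(N), |3(a + d) − c| ≤ 6 }`
(the fixed-point symbols).  Knapp's Prop. 11.22 is supplied by the Literature theorem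
`periodFunctional_ker_le_ellipticParabolic_sup_commutator_holds`. [cite: Knapp1993, Prop. 11.22 (PDF p. 242)] -/
theorem prymLatticeFixedPointSpan_proof : PrymLatticeFixedPointSpan :=
  prymLatticeFixedPointSpan_of_periodKernelFact
    Literature.NumberTheory.ModularSymbols.periodFunctional_ker_le_ellipticParabolic_sup_commutator_holds

/-- **E30 `PrymDefectHeckeEisensteinSplit` (stmt-BirchSwinnertonDyer-23597), PROVED**: for `9 ∣ N` and primes
`p ≡ 1 (mod N)`, `(T_p − 2)Λ_P ⊆ (t − 1)Λ` — the Hecke action on the Hilbert-90 defect is Eisenstein.  E32a (above) and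
E32b (`stub_fixedPointSymbolHeckeShift`, p682044) through the landed glue `heckeEisensteinSplit_of`. [folklore] -/
theorem prymDefectHeckeEisensteinSplit_proof : PrymDefectHeckeEisensteinSplit :=
  heckeEisensteinSplit_of prymLatticeFixedPointSpan_proof stub_fixedPointSymbolHeckeShift

/-- **H2 `TprimeIrrPrymDefectAvoidsThree` (stmt-BirchSwinnertonDyer-23480), PROVED**: the twisted mod-`3` system of a
III-row curve does not occur in the Prym defect `Λ_P/(t − 1)Λ`.  E30 (above) and B30 (`stub_traceWitness`, p675317)
through the landed glue `prymDefectAvoidsThree_of_eisensteinSplit_of_traceWitness` (p673875). [folklore] -/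
theorem tprimeIrrPrymDefectAvoidsThree_proof : TprimeIrrPrymDefectAvoidsThree :=
  prymDefectAvoidsThree_of_eisensteinSplit_of_traceWitness prymDefectHeckeEisensteinSplit_proof stub_traceWitness

end Summit.BirchSwinnertonDyer.BirchSwinnertonDyer.Theorems.TameQuarticManinParity

end
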